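import Summits.AnomalousDissipation.AnomalousDissipation.Theorems.SawtoothPulseCascadeK1LocalisedCascadePhaseTwoStartBox20

/-!
# K1loc, line `Spectral` / thin start — helper: PHASE-TWO START BOX VII — the half-step hypotheses reduced to JUNK REGIONS

Helper file of the prover lane on the crux `K1LocalisedCascade` (stmt-AnomalousDissipation-19491), route `SawtoothPulseCascade`
(glue seat; start box of record `StartBoxTwo`, arbiter A23-13 (1)).  The hypotheses (hT)/(hS) of `phaseTwo_start20_le` compare a
class AFTER a half-step with a class BEFORE it; since the H half-step preserves every horizontal spectral functional and the V
half-step every vertical one (`…FibreMarginals`), each reduces to a bound on a pure JUNK REGION of the output: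
* `lowFibres_hstep_le_strip_add`: `b = a ∘ Φ_H` ⇒ `Σ'[|k₁| < K′]‖𝓕b‖² ≤ Σ'[|k₀| < K]‖𝓕a‖² + Σ'[K ≤ |k₀| ∧ |k₁| < K′]‖𝓕b‖²`;
* `strip_vstep_le_lowFibres_add`: `a′ = b ∘ Φ_V` ⇒ `Σ'[|k₀| < K₂]‖𝓕a′‖² ≤ Σ'[|k₁| < K′]‖𝓕b‖² + Σ'[K′ ≤ |k₁| ∧ |k₀| < K₂]‖𝓕a′‖²`;
* **`phaseTwo_start20_le_of_junk`**: the start box with the three JUNK-REGION bounds as hypotheses —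
  (hJH) `Σ'[20 ≤ |k₀| ∧ |k₁| < K′]‖𝓕b₁‖² ≤ j_H`, (hJV) `Σ'[K′ ≤ |k₁| ∧ |k₀| < 800]‖𝓕a₂‖² ≤ j_V`,
  (hO) `Σ'[800 ≤ |k₀| ∧ |k₀| ≤ 4|k₁|]‖𝓕a₂‖² ≤ j_O` ⇒ `S_2(800) + O_2(800) ≤ 8/625 + j_H + j_V + j_O`.
These three regions are exactly what the corner-trace dischargers bound (sizing memo `CT-PHASE1-SIZING-k1locp3g4.md`: truths
`3.5·10⁻⁴ / 4·10⁻⁵ / 6·10⁻⁵` at `K′ = 130`).  No definitions; nothing about the crux at `δ₀ = ¼`.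
[cite: Grafakos2014, Prop. 3.1.2 (5) and Prop. 3.2.7 (3)] [problem: turb]
-/

-- `Summit.<Summit>.<Problem>`: single-conjunct summit, the duplicate namespace segment is deliberate.
set_option linter.dupNamespace false

noncomputable section

namespace Summit.AnomalousDissipation.AnomalousDissipation.Theorems.SawtoothPulseCascade.K1Start

open MeasureTheory Set Filter Topology UnitAddTorus Function Complex AddCircle
open scoped Real
open Literature.Analysis Literature.Analysis.FunctionSpaces Literature.Analysis.FunctionSpaces.Torus Literature.Analysis.FluidPDE
open Literature.Analysis.FluidPDE.ShearStage
open Literature.Analysis.FluidPDE.SawtoothCascade Literature.Analysis.FluidPDE.SawtoothCascade.CascadeParams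

/-! ## §1 Indicator bookkeeping for square-summable coefficient families -/

/-- **Splitting an indicator functional**: if `w ≤ w₁ + w₂` pointwise with `0 ≤ w, w₁, w₂ ≤ 1` and `c ≥ 0` summable, then
`Σ' w·c ≤ Σ' w₁·c + Σ' w₂·c`. [folklore] -/
theorem tsum_indicator_split {ι : Type*} {c : ι → ℝ} (hcs : Summable c) (hc0 : ∀ k, 0 ≤ c k) {w w₁ w₂ : ι → ℝ}
    (hw0 : ∀ k, 0 ≤ w k) (hw1 : ∀ k, w k ≤ 1) (hw₁0 : ∀ k, 0 ≤ w₁ k) (hw₁1 : ∀ k, w₁ k ≤ 1) (hw₂0 : ∀ k, 0 ≤ w₂ k)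
    (hw₂1 : ∀ k, w₂ k ≤ 1) (hle : ∀ k, w k ≤ w₁ k + w₂ k) :
    ∑' k, w k * c k ≤ ∑' k, w₁ k * c k + ∑' k, w₂ k * c k := by
  have hI : ∀ (v : ι → ℝ), (∀ k, 0 ≤ v k) → (∀ k, v k ≤ 1) → Summable fun k => v k * c k := fun v hv0 hv1 =>
    Summable.of_nonneg_of_le (fun k => mul_nonneg (hv0 k) (hc0 k)) (fun k => mul_le_of_le_one_left (hc0 k) (hv1 k)) hcs
  rw [← (hI w₁ hw₁0 hw₁1).tsum_add (hI w₂ hw₂0 hw₂1)]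
  refine Summable.tsum_le_tsum (fun k => ?_) (hI w hw0 hw1) ((hI w₁ hw₁0 hw₁1).add (hI w₂ hw₂0 hw₂1))
  rw [← add_mul]
  exact mul_le_mul_of_nonneg_right (hle k) (hc0 k)

/-! ## §2 The H half-step: low fibres from the strip, up to the junk region -/

/-- **(hT) REDUCED TO ITS JUNK REGION**: for `b = a ∘ shearMap 0 1 ψ` (`a` continuous) and any thresholds `K, K′`,
`Σ'[|k₁| < K′]‖𝓕b‖² ≤ Σ'[|k₀| < K]‖𝓕a‖² + Σ'[K ≤ |k₀| ∧ |k₁| < K′]‖𝓕b‖²` (the strip functional is H-invariant).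
[cite: Grafakos2014, Prop. 3.2.7 (3)] -/
theorem lowFibres_hstep_le_strip_add {a b : UnitAddTorus (Fin 2) → ℝ} (ha : Continuous a) (ψ : ShearProfile)
    (hb : b = a ∘ shearMap 0 1 ψ) (K K' : ℕ) :
    ∑' k : Fin 2 → ℤ, (if |k 1| < (K' : ℤ) then (1 : ℝ) else 0) * ‖mFourierCoeff (fun x => (b x : ℂ)) k‖ ^ 2 ≤
      ∑' k : Fin 2 → ℤ, (if |k 0| < (K : ℤ) then (1 : ℝ) else 0) * ‖mFourierCoeff (fun x => (a x : ℂ)) k‖ ^ 2 +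
        ∑' k : Fin 2 → ℤ, (if (K : ℤ) ≤ |k 0| ∧ |k 1| < (K' : ℤ) then (1 : ℝ) else 0) *
          ‖mFourierCoeff (fun x => (b x : ℂ)) k‖ ^ 2 := by
  have hbc : Continuous b := by rw [hb]; exact ha.comp (continuous_shearMap 0 1 ψ)
  have hbc' : Continuous fun x => (b x : ℂ) := Complex.continuous_ofReal.comp hbc
  set c : (Fin 2 → ℤ) → ℝ := fun k => ‖mFourierCoeff (fun x => (b x : ℂ)) k‖ ^ 2 with hc
  have hcs : Summable c := (hasSum_sq_mFourierCoeff_of_continuous hbc').summable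
  have hc0 : ∀ k, 0 ≤ c k := fun k => sq_nonneg _
  -- the strip functional of `b` equals that of `a`
  have hinv : ∑' k : Fin 2 → ℤ, (if |k 0| < (K : ℤ) then (1 : ℝ) else 0) * ‖mFourierCoeff (fun x => (b x : ℂ)) k‖ ^ 2 =
      ∑' k : Fin 2 → ℤ, (if |k 0| < (K : ℤ) then (1 : ℝ) else 0) * ‖mFourierCoeff (fun x => (a x : ℂ)) k‖ ^ 2 :=
    tsum_horizontalWeight_hstep ha ψ hb (w := fun m => if |m| < (K : ℤ) then (1 : ℝ) else 0) (C := 1)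
      (fun m => by split_ifs <;> norm_num)
  rw [← hinv]
  refine tsum_indicator_split hcs hc0 (fun k => by split_ifs <;> norm_num) (fun k => by split_ifs <;> norm_num)
    (fun k => by split_ifs <;> norm_num) (fun k => by split_ifs <;> norm_num) (fun k => by split_ifs <;> norm_num)
    (fun k => by split_ifs <;> norm_num) (fun k => ?_)
  by_cases h1 : |k 1| < (K' : ℤ)
  · rw [if_pos h1]
    by_cases h0 : |k 0| < (K : ℤ)
    · rw [if_pos h0]; split_ifs <;> norm_num
    · rw [if_neg h0, if_pos ⟨not_lt.1 h0, h1⟩]; norm_num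
  · rw [if_neg h1]
    have := (show (0 : ℝ) ≤ (if |k 0| < (K : ℤ) then (1 : ℝ) else 0) by split_ifs <;> norm_num)
    have := (show (0 : ℝ) ≤ (if (K : ℤ) ≤ |k 0| ∧ |k 1| < (K' : ℤ) then (1 : ℝ) else 0) by split_ifs <;> norm_num)
    linarith

/-! ## §3 The V half-step: the strip from the low fibres, up to the junk region -/

/-- **(hS) REDUCED TO ITS JUNK REGION**: for `a′ = b ∘ shearMap 1 0 ψ` (`b` continuous) and any thresholds `K′, K₂`,
`Σ'[|k₀| < K₂]‖𝓕a′‖² ≤ Σ'[|k₁| < K′]‖𝓕b‖² + Σ'[K′ ≤ |k₁| ∧ |k₀| < K₂]‖𝓕a′‖²` (the low-fibre functional is V-invariant).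
[cite: Grafakos2014, Prop. 3.2.7 (3)] -/
theorem strip_vstep_le_lowFibres_add {b a' : UnitAddTorus (Fin 2) → ℝ} (hb : Continuous b) (ψ : ShearProfile)
    (ha' : a' = b ∘ shearMap 1 0 ψ) (K' K₂ : ℕ) :
    ∑' k : Fin 2 → ℤ, (if |k 0| < (K₂ : ℤ) then (1 : ℝ) else 0) * ‖mFourierCoeff (fun x => (a' x : ℂ)) k‖ ^ 2 ≤
      ∑' k : Fin 2 → ℤ, (if |k 1| < (K' : ℤ) then (1 : ℝ) else 0) * ‖mFourierCoeff (fun x => (b x : ℂ)) k‖ ^ 2 +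
        ∑' k : Fin 2 → ℤ, (if (K' : ℤ) ≤ |k 1| ∧ |k 0| < (K₂ : ℤ) then (1 : ℝ) else 0) *
          ‖mFourierCoeff (fun x => (a' x : ℂ)) k‖ ^ 2 := by
  have hac : Continuous a' := by rw [ha']; exact hb.comp (continuous_shearMap 1 0 ψ)
  have hac' : Continuous fun x => (a' x : ℂ) := Complex.continuous_ofReal.comp hac
  set c : (Fin 2 → ℤ) → ℝ := fun k => ‖mFourierCoeff (fun x => (a' x : ℂ)) k‖ ^ 2 with hc
  have hcs : Summable c := (hasSum_sq_mFourierCoeff_of_continuous hac').summable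
  have hc0 : ∀ k, 0 ≤ c k := fun k => sq_nonneg _
  have hinv : ∑' k : Fin 2 → ℤ, (if |k 1| < (K' : ℤ) then (1 : ℝ) else 0) * ‖mFourierCoeff (fun x => (a' x : ℂ)) k‖ ^ 2 =
      ∑' k : Fin 2 → ℤ, (if |k 1| < (K' : ℤ) then (1 : ℝ) else 0) * ‖mFourierCoeff (fun x => (b x : ℂ)) k‖ ^ 2 :=
    tsum_verticalWeight_vstep hb ψ ha' (w := fun m => if |m| < (K' : ℤ) then (1 : ℝ) else 0) (C := 1)
      (fun m => by split_ifs <;> norm_num)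
  rw [← hinv]
  refine tsum_indicator_split hcs hc0 (fun k => by split_ifs <;> norm_num) (fun k => by split_ifs <;> norm_num)
    (fun k => by split_ifs <;> norm_num) (fun k => by split_ifs <;> norm_num) (fun k => by split_ifs <;> norm_num)
    (fun k => by split_ifs <;> norm_num) (fun k => ?_)
  by_cases h0 : |k 0| < (K₂ : ℤ)
  · rw [if_pos h0]
    by_cases h1 : |k 1| < (K' : ℤ)
    · rw [if_pos h1]; split_ifs <;> norm_num
    · rw [if_neg h1, if_pos ⟨not_lt.1 h1, h0⟩]; norm_num
  · rw [if_neg h0]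
    have := (show (0 : ℝ) ≤ (if |k 1| < (K' : ℤ) then (1 : ℝ) else 0) by split_ifs <;> norm_num)
    have := (show (0 : ℝ) ≤ (if (K' : ℤ) ≤ |k 1| ∧ |k 0| < (K₂ : ℤ) then (1 : ℝ) else 0) by split_ifs <;> norm_num)
    linarith

/-! ## §4 The start box with junk-region hypotheses -/

section Cascade

variable (P : CascadeParams)

/-- **THE PHASE-TWO START BOX FROM JUNK-REGION BOUNDS** (`StartBoxTwo`, `K_2 = 800`, `a₁`-strip `20`, any `K′`):
`γ = 8`, `N₀ = 1`, `0 < δ₀ ≤ 2⁻³⁰`, and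
(hJH) `Σ'[20 ≤ |k₀| ∧ |k₁| < K′]‖𝓕b₁‖² ≤ j_H`, (hJV) `Σ'[K′ ≤ |k₁| ∧ |k₀| < 800]‖𝓕a₂‖² ≤ j_V`,
(hO) `Σ'[800 ≤ |k₀| ∧ |k₀| ≤ 4|k₁|]‖𝓕a₂‖² ≤ j_O` ⇒ **`S_2(800) + O_2(800) ≤ 8/625 + j_H + j_V + j_O`**.
[cite: Grafakos2014, Prop. 3.1.2 (5) and Prop. 3.2.7 (3)] -/
theorem phaseTwo_start20_le_of_junk (hγ : P.γ = 8) (hN₀ : P.N₀ = 1) (hδ₀ : 0 < P.δ₀) (hδ₀' : P.δ₀ ≤ (2 : ℝ)⁻¹ ^ 30)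
    (hd : 0 < P.d) (a b : ℕ → UnitAddTorus (Fin 2) → ℝ) (h0 : a 0 = datum)
    (hb : ∀ j, b j = a j ∘ shearMap 0 1 (amp ⟨P.U j, P.U_periodic j, P.contDiff_U (P.δ_pos hδ₀ hd j)⟩ P.γ))
    (hab : ∀ j, a (j + 1) = b j ∘ shearMap 1 0 (amp ⟨P.U j, P.U_periodic j, P.contDiff_U (P.δ_pos hδ₀ hd j)⟩ P.γ))
    (K' : ℕ) {jH jV jO : ℝ}
    (hJH : ∑' k : Fin 2 → ℤ, (if ((20 : ℕ) : ℤ) ≤ |k 0| ∧ |k 1| < (K' : ℤ) then (1 : ℝ) else 0) *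
      ‖mFourierCoeff (fun x => (b 1 x : ℂ)) k‖ ^ 2 ≤ jH)
    (hJV : ∑' k : Fin 2 → ℤ, (if (K' : ℤ) ≤ |k 1| ∧ |k 0| < ((800 : ℕ) : ℤ) then (1 : ℝ) else 0) *
      ‖mFourierCoeff (fun x => (a 2 x : ℂ)) k‖ ^ 2 ≤ jV)
    (hO : ∑' k : Fin 2 → ℤ, (if ((800 : ℕ) : ℤ) ≤ |k 0| ∧ ((1 : ℕ) : ℤ) * |k 0| ≤ ((4 : ℕ) : ℤ) * |k 1| then (1 : ℝ) else 0) *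
      ‖mFourierCoeff (fun x => (a 2 x : ℂ)) k‖ ^ 2 ≤ jO) :
    ∑' k : Fin 2 → ℤ, (if |k 0| < ((800 : ℕ) : ℤ) then (1 : ℝ) else 0) * ‖mFourierCoeff (fun x => (a 2 x : ℂ)) k‖ ^ 2 +
        ∑' k : Fin 2 → ℤ, (if ((800 : ℕ) : ℤ) ≤ |k 0| ∧ ((1 : ℕ) : ℤ) * |k 0| ≤ ((4 : ℕ) : ℤ) * |k 1| then (1 : ℝ) else 0) *
          ‖mFourierCoeff (fun x => (a 2 x : ℂ)) k‖ ^ 2 ≤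
      8 / 625 + jH + jV + jO := by
  -- continuity of the iterates
  set ψ₀ : ShearProfile := amp ⟨P.U 0, P.U_periodic 0, P.contDiff_U (P.δ_pos hδ₀ hd 0)⟩ P.γ with hψ₀
  set ψ₁ : ShearProfile := amp ⟨P.U 1, P.U_periodic 1, P.contDiff_U (P.δ_pos hδ₀ hd 1)⟩ P.γ with hψ₁
  have hb0 : b 0 = datum ∘ shearMap 0 1 ψ₀ := by rw [hb 0, h0]
  have ha1 : a 1 = b 0 ∘ shearMap 1 0 ψ₀ := hab 0
  have ha1c : Continuous (a 1) := by
    rw [ha1, hb0]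
    exact (isSmooth_datum_comp_shearMap ψ₀).continuous.comp (continuous_shearMap 1 0 ψ₀)
  have hb1 : b 1 = a 1 ∘ shearMap 0 1 ψ₁ := hb 1
  have hb1c : Continuous (b 1) := by rw [hb1]; exact ha1c.comp (continuous_shearMap 0 1 ψ₁)
  have ha2 : a 2 = b 1 ∘ shearMap 1 0 ψ₁ := hab 1
  -- the two reductions
  have hT := lowFibres_hstep_le_strip_add ha1c ψ₁ hb1 20 K'
  have hS := strip_vstep_le_lowFibres_add hb1c ψ₁ ha2 K' 800
  refine phaseTwo_start20_le P hγ hN₀ hδ₀ hδ₀' hd a b h0 hb hab K' (jH := jH) (jV := jV) (jO := jO) ?_ ?_ hO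
  · exact hT.trans (by linarith)
  · refine hS.trans ?_
    have e : (((800 : ℕ) : ℤ)) = (800 : ℤ) := by norm_num
    linarith

end Cascade

end Summit.AnomalousDissipation.AnomalousDissipation.Theorems.SawtoothPulseCascade.K1Start
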